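import Summits.CriticalPhenomena.PercolationContinuityZ3.Theorems.PercNearOneGluingNoHeavyRsw3InvasionTreeAcyclic
import Summits.CriticalPhenomena.PercolationContinuityZ3.Theorems.PercNearOneGluingNoHeavyRsw3InvasionOneEnded
import HarnessLib

/-!
# RSW3 lane (P2, gen 29): INVASION PERCOLATION XXXV — THE BACKBONE IS UNIQUE: the invasion tree has AT MOST ONE self-avoiding ray from the root
# (every infinite connected graph with outlets beyond every time; a.s. on `ℤ^d`, `d ≥ 2`, by p205010)

builds on p205010 (kernel theorem, internal audit signed; external expert review pending) — used only in the `ℤ^d` statements (through file XXX).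

Cell `prim-rsw3`, prover seat `prim-rsw3-p2` (gen 29), memo `run/shared/lean/prim/rsw3/P2-RSWLITE.md` §36.  Support file
(`--supports stmt-CriticalPhenomena-4575`); no definitions, no named facts, no sorries.

One end (file XXIX: two rays from the root share an oriented edge beyond every index) + acyclicity (file XXXIII) give UNIQUENESS of the ray from the root: two
distinct self-avoiding rays `r ≠ r'` from `o` first differ at some index `j ≥ 1` and meet again later, producing two distinct paths between the same vertices of
the tree — impossible in an acyclic graph (Mathlib `IsAcyclic.path_unique`).  So the "backbone" of Damron–Sapozhnikov (the infinite self-avoiding path of the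
invasion from the origin), when it exists, is unique and passes through every outlet (`ray_crosses_outlet`).

* `exists_walk_support_eq` — the initial segment `r 0, …, r k` of a sequence with consecutive adjacencies is a walk with that support (a path when `r` is injective).
* `eq_one_of_isAcyclic_of_meet` — in an acyclic graph two injective such sequences from the same vertex that meet again agree at index `1`.
* **`ray_unique`** — every graph: outlets beyond every time ⇒ any two self-avoiding rays of `Invasion.tree G U o` from `o` are EQUAL.
* **`ae_ray_unique`** (`ℤ^d`, `d ≥ 2`): a.s. the invasion tree of `ℤ^d` has at most one ray from the origin; `ae_ray_unique_Z3`.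

References: R. Lyons, Y. Peres, O. Schramm, Ann. Probab. 34 (2006), Thm. 3.12 (proof) [LyonsPeresSchramm2006]; M. Damron, A. Sapozhnikov, PTRF (2010) §1.3 (the backbone of
the invasion).
-/

noncomputable section

namespace Summit.CriticalPhenomena.PercolationContinuityZ3.Theorems.Rsw3

open Finset Filter MeasureTheory Literature.Probability.LatticeModels Literature.Probability.Percolation Literature.Probability.Percolation.Invasion

section General

variable {V : Type*} [DecidableEq V] {G : SimpleGraph V} [G.LocallyFinite]

omit [DecidableEq V] [G.LocallyFinite] in
/-- The initial segment `r 0, r 1, …, r k` of a sequence with consecutive adjacencies is a walk with exactly that support. [folklore] -/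
theorem exists_walk_support_eq {H : SimpleGraph V} (r : ℕ → V) (hadj : ∀ i, H.Adj (r i) (r (i + 1))) :
    ∀ k : ℕ, ∃ p : H.Walk (r 0) (r k), p.support = (List.range (k + 1)).map r
  | 0 => ⟨SimpleGraph.Walk.nil, by simp⟩
  | k + 1 => by
    obtain ⟨p, hp⟩ := exists_walk_support_eq r hadj k
    refine ⟨p.concat (hadj k), ?_⟩
    rw [SimpleGraph.Walk.support_concat, hp]
    conv_rhs => rw [List.range_succ, List.map_append, List.map_singleton]

omit [DecidableEq V] [G.LocallyFinite] in
/-- In an ACYCLIC graph, two injective sequences with consecutive adjacencies that start at the same vertex and meet again (`r i = r' i'` with `i, i' ≥ 1`) agree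
at index `1` (uniqueness of paths). [folklore] -/
theorem eq_one_of_isAcyclic_of_meet {H : SimpleGraph V} (hH : H.IsAcyclic) {r r' : ℕ → V} (hr : Function.Injective r) (hr' : Function.Injective r')
    (hadj : ∀ i, H.Adj (r i) (r (i + 1))) (hadj' : ∀ i, H.Adj (r' i) (r' (i + 1))) (h0 : r 0 = r' 0) {i i' : ℕ} (hi : 1 ≤ i) (hi' : 1 ≤ i')
    (hmeet : r i = r' i') : r 1 = r' 1 := by
  obtain ⟨p, hp⟩ := exists_walk_support_eq r hadj i
  obtain ⟨p', hp'⟩ := exists_walk_support_eq r' hadj' i'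
  have hpath : p.IsPath := by
    rw [SimpleGraph.Walk.isPath_def, hp]
    exact (List.nodup_range).map hr
  have hpath' : p'.IsPath := by
    rw [SimpleGraph.Walk.isPath_def, hp']
    exact (List.nodup_range).map hr'
  -- transport `p'` to a walk from `r 0` to `r i` and compare supports
  have key : ∀ {u w : V} (q : H.Walk u w) (_ : q.IsPath) (hu : u = r 0) (hw : w = r i),
      (q.copy hu hw).support = p.support := by
    intro u w q hq hu hw
    subst hu; subst hw
    have := hH.path_unique ⟨q.copy rfl rfl, by simpa using hq⟩ ⟨p, hpath⟩
    simpa using congrArg (fun P : H.Path (r 0) (r i) => P.1.support) this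
  have hsupp := key p' hpath' h0.symm hmeet.symm
  rw [SimpleGraph.Walk.support_copy, hp', hp] at hsupp
  have h1 : ((List.range (i' + 1)).map r')[1]? = ((List.range (i + 1)).map r)[1]? := by rw [hsupp]
  rw [List.getElem?_map, List.getElem?_map, List.getElem?_range (by omega), List.getElem?_range (by omega)] at h1
  simpa using h1.symm

/-- **THE RAY FROM THE ROOT IS UNIQUE** (every infinite connected locally finite graph, outlets beyond every time): any two self-avoiding rays of the invasion tree
from the root coincide — they share an oriented edge beyond every index (one end, file XXIX) and the tree is acyclic (file XXXIII), so they can never differ.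
[cite: LyonsPeresSchramm2006, Thm. 3.12 (proof)] -/
theorem ray_unique [Infinite V] (hG : G.Preconnected) {U : Sym2 V → ℝ} {o : V} (hout : ∀ k, ∃ m, k ≤ m ∧ IsOutlet G U o m)
    {r r' : ℕ → V} (hr : Function.Injective r) (hr' : Function.Injective r') (h0 : r 0 = o) (h0' : r' 0 = o)
    (hadj : ∀ i, (tree G U o).Adj (r i) (r (i + 1))) (hadj' : ∀ i, (tree G U o).Adj (r' i) (r' (i + 1))) : r = r' := by
  classical
  by_contra hne
  have hex : ∃ j, r j ≠ r' j := by
    by_contra h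
    push Not at h
    exact hne (funext h)
  -- the first index of disagreement, `j ≥ 1`
  have hj_spec : r (Nat.find hex) ≠ r' (Nat.find hex) := Nat.find_spec hex
  have hj0 : Nat.find hex ≠ 0 := fun h => by rw [h] at hj_spec; exact hj_spec (h0.trans h0'.symm)
  have hagree : ∀ t, t < Nat.find hex → r t = r' t := fun t ht => not_not.1 (Nat.find_min hex ht)
  obtain ⟨j₀, hj₀⟩ := Nat.exists_eq_succ_of_ne_zero hj0
  -- the rays meet again beyond `j`
  obtain ⟨i, i', hji, hmeet, -⟩ := rays_meet_beyond hG hout hr hr' h0 h0' hadj hadj' (Nat.find hex)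
  -- `i' ≥ j` as well: otherwise `r i = r' i' = r i'` with `i' < j ≤ i`
  have hji' : Nat.find hex ≤ i' := by
    by_contra hlt
    push Not at hlt
    have := hr (hmeet.trans (hagree i' hlt).symm)
    omega
  -- shift both rays to start at `r j₀ = r' j₀` (`j = j₀ + 1`) and apply uniqueness of paths in the acyclic tree
  have hstart : r j₀ = r' j₀ := hagree j₀ (by omega)
  have key := eq_one_of_isAcyclic_of_meet (tree_isAcyclic U o) (r := fun t => r (j₀ + t)) (r' := fun t => r' (j₀ + t))
    (fun a b hab => by simpa using hr hab) (fun a b hab => by simpa using hr' hab)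
    (fun t => by simpa [Nat.add_assoc] using hadj (j₀ + t)) (fun t => by simpa [Nat.add_assoc] using hadj' (j₀ + t))
    (by simpa using hstart) (i := i - j₀) (i' := i' - j₀) (by omega) (by omega)
    (by simpa [Nat.add_sub_cancel' (by omega : j₀ ≤ i), Nat.add_sub_cancel' (by omega : j₀ ≤ i')] using hmeet)
  rw [hj₀] at hj_spec
  exact hj_spec (by simpa using key)

end General

/-! ## `ℤ^d` -/

variable {d : ℕ}

/-- **A.S. THE INVASION TREE OF `ℤ^d` HAS AT MOST ONE RAY FROM THE ORIGIN** (`d ≥ 2`, p205010): any two self-avoiding rays of `Invasion.tree (zdGraph d) U 0` starting at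
`0` are equal — the backbone of the invasion is unique (and passes through every outlet, file XXX). [cite: LyonsPeresSchramm2006, Thm. 3.12 (proof)] -/
theorem ae_ray_unique (hd : 2 ≤ d) :
    ∀ᵐ U ∂(labelMeasure (Site d)), ∀ r r' : ℕ → Site d, Function.Injective r → Function.Injective r' → r 0 = 0 → r' 0 = 0 →
      (∀ i, (tree (zdGraph d) U 0).Adj (r i) (r (i + 1))) → (∀ i, (tree (zdGraph d) U 0).Adj (r' i) (r' (i + 1))) → r = r' := by
  haveI : Nonempty (Fin d) := ⟨⟨0, by omega⟩⟩
  haveI : Infinite (Site d) := Pi.infinite_of_right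
  filter_upwards [ae_forall_exists_isOutlet hd] with U hU
  intro r r' hr hr' h0 h0' hadj hadj'
  exact ray_unique zdGraph_preconnected_holds (fun k => (hU k).imp fun m hm => ⟨hm.1, hm.2.1⟩) hr hr' h0 h0' hadj hadj'

/-- `ℤ³`: a.s. the invasion tree has at most one ray from the origin. [cite: LyonsPeresSchramm2006, Thm. 3.12 (proof)] -/
theorem ae_ray_unique_Z3 :
    ∀ᵐ U ∂(labelMeasure (Site 3)), ∀ r r' : ℕ → Site 3, Function.Injective r → Function.Injective r' → r 0 = 0 → r' 0 = 0 →
      (∀ i, (tree (zdGraph 3) U 0).Adj (r i) (r (i + 1))) → (∀ i, (tree (zdGraph 3) U 0).Adj (r' i) (r' (i + 1))) → r = r' :=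
  ae_ray_unique (by norm_num)

end Summit.CriticalPhenomena.PercolationContinuityZ3.Theorems.Rsw3
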